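import Mathlib

/-!
# The three-component mixture: the algebraic core of the free-part theorem
(blind cell PercRepro2, p5 g36; S4 §2.4 (s) addendum 38 (4)–(5))

When the marked routes `π₁ ∋ o`, `π₂ ∋ b` form a two-route core and every other `a₁`–`v`
connection runs through a free part attached at `a₁`, `v` (and to `a₂` by coins), the law of
`K = C(a₂)` on `Q = {a₂ ↮ a₁}` is a MIXTURE `A·m″ + G·m^on + B·m_v̄` of the core law `m″`
(route function `γ₁₂`, `Dv = 0`), a law `m^on` on which `v ∈ K` surely (all route masses `0`)
and the `v ∉ K` part `m_v̄ = (s, u, w, u, w, τ)` of the core law with route function `1`.  The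
cross functional `Φ_C(m) = 2Z·Dv − y·xv − x·yv + C·x·y` of the mixture is nonnegative from
* the two-route crux of `m″` at `π̃ = P₁ + P₂ − P₁P₂` (`T ≥ 0`) and its route-mass bounds
  `xv″ ≤ P₂·u`, `yv″ ≤ P₁·w`, `xv″ ≤ π̃·x″`, `yv″ ≤ π̃·y″`, with `u ≤ x″`, `w ≤ y″`, `s ≤ Z″`;
* BHK with the avoidance of `{a₁, v}`: `u·w ≤ τ·s`;
* the weight condition `(C − π̃)·A ≥ (1 − C)·B` (Harris for the free part) and `π̃ ≤ C ≤ 1`.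
`mixture_nonneg` is the explicit certificate; the single free edge is the case `G = 0`,
`A = 1 − q`, `B = q`, `C = q + (1 − q)π̃` (`CrossAPrimeFreeEdge`).  Own work; standard axioms.
-/

namespace Summit.Ventures.PercRepro2.CrossAPrimeMixtureAlgebra

variable {R : Type*} [Field R] [LinearOrder R] [IsStrictOrderedRing R]

omit [LinearOrder R] [IsStrictOrderedRing R] in
/-- The certificate identity behind `mixture_nonneg` (`pit = P₁ + P₂ − P₁P₂`). -/
lemma mixture_certificate (A G B C P₁ P₂ Z'' x'' y'' xv'' yv'' s u w τ Zon xon yon : R) :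
    2 * (A * Z'' + G * Zon + B * s) * (B * τ) -
        (A * y'' + G * yon + B * w) * (A * xv'' + B * u) -
        (A * x'' + G * xon + B * u) * (A * yv'' + B * w) +
        C * (A * x'' + G * xon + B * u) * (A * y'' + G * yon + B * w) =
      A ^ 2 * (-y'' * xv'' - x'' * yv'' + (P₁ + P₂ - P₁ * P₂) * x'' * y'') +
        A * G * ((P₁ + P₂ - P₁ * P₂) * (x'' * yon + xon * y'') - xv'' * yon - yv'' * xon) +
        G ^ 2 * C * (xon * yon) + 2 * G * B * Zon * τ + 2 * A * B * (Z'' - s) * τ +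
        2 * A * B * (τ * s - u * w) +
        A * B * (w * (P₂ * u - xv'') + u * (P₁ * w - yv'')) +
        B ^ 2 * (2 * (τ * s - u * w)) + B ^ 2 * C * (u * w) +
        A * B * (u * w) * (2 * C - P₁ - P₂) +
        ((A * (C - (P₁ + P₂ - P₁ * P₂)) - B * (1 - C)) *
            (A * (u * (y'' - w) + w * (x'' - u)) + G * (u * yon + w * xon)) +
          A ^ 2 * (C - (P₁ + P₂ - P₁ * P₂)) * (u * w + (x'' - u) * (y'' - w)) +
          A * G * (C - (P₁ + P₂ - P₁ * P₂)) * ((x'' - u) * yon + xon * (y'' - w))) := by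
  ring

/-- **The three-component mixture is nonnegative** (see the module docstring for the roles of
the variables). -/
theorem mixture_nonneg {A G B C P₁ P₂ Z'' x'' y'' xv'' yv'' s u w τ Zon xon yon : R}
    (hA : 0 ≤ A) (hG : 0 ≤ G) (hB : 0 ≤ B)
    (hP₁ : 0 ≤ P₁) (hP₁' : P₁ ≤ 1) (hP₂ : 0 ≤ P₂) (hP₂' : P₂ ≤ 1)
    (hCpit : P₁ + P₂ - P₁ * P₂ ≤ C) (hC1 : C ≤ 1)
    (hweight : (1 - C) * B ≤ (C - (P₁ + P₂ - P₁ * P₂)) * A)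
    (hs : s ≤ Z'') (hu0 : 0 ≤ u) (hw0 : 0 ≤ w) (hτ0 : 0 ≤ τ)
    (hxu : u ≤ x'') (hyw : w ≤ y'')
    (hxv : xv'' ≤ P₂ * u) (hyv : yv'' ≤ P₁ * w)
    (hxvπ : xv'' ≤ (P₁ + P₂ - P₁ * P₂) * x'') (hyvπ : yv'' ≤ (P₁ + P₂ - P₁ * P₂) * y'')
    (hbhk : u * w ≤ τ * s)
    (htwo : 0 ≤ -y'' * xv'' - x'' * yv'' + (P₁ + P₂ - P₁ * P₂) * x'' * y'')
    (hZon : 0 ≤ Zon) (hxon : 0 ≤ xon) (hyon : 0 ≤ yon) :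
    0 ≤ 2 * (A * Z'' + G * Zon + B * s) * (B * τ) -
        (A * y'' + G * yon + B * w) * (A * xv'' + B * u) -
        (A * x'' + G * xon + B * u) * (A * yv'' + B * w) +
        C * (A * x'' + G * xon + B * u) * (A * y'' + G * yon + B * w) := by
  rw [mixture_certificate A G B C P₁ P₂ Z'' x'' y'' xv'' yv'' s u w τ Zon xon yon]
  set pit := P₁ + P₂ - P₁ * P₂ with hpit
  have hpit0 : 0 ≤ pit := by nlinarith
  have hC0 : 0 ≤ C := by linarith
  have h2C : 0 ≤ 2 * C - P₁ - P₂ := by nlinarith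
  have hCp : 0 ≤ C - pit := by linarith
  have hC' : 0 ≤ 1 - C := by linarith
  have hxv_ : 0 ≤ x'' - u := by linarith
  have hyv_ : 0 ≤ y'' - w := by linarith
  have hW : 0 ≤ A * (C - pit) - B * (1 - C) := by linarith
  have t1 : 0 ≤ A ^ 2 * (-y'' * xv'' - x'' * yv'' + pit * x'' * y'') :=
    mul_nonneg (sq_nonneg _) htwo
  have t2 : 0 ≤ A * G * (pit * (x'' * yon + xon * y'') - xv'' * yon - yv'' * xon) := by
    refine mul_nonneg (mul_nonneg hA hG) ?_
    have a1 : xv'' * yon ≤ pit * x'' * yon := mul_le_mul_of_nonneg_right hxvπ hyon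
    have a2 : yv'' * xon ≤ pit * y'' * xon := mul_le_mul_of_nonneg_right hyvπ hxon
    have e : pit * (x'' * yon + xon * y'') - xv'' * yon - yv'' * xon =
        (pit * x'' * yon - xv'' * yon) + (pit * y'' * xon - yv'' * xon) := by ring
    rw [e]
    exact add_nonneg (by linarith) (by linarith)
  have t3 : 0 ≤ G ^ 2 * C * (xon * yon) :=
    mul_nonneg (mul_nonneg (sq_nonneg _) hC0) (mul_nonneg hxon hyon)
  have t4 : 0 ≤ 2 * G * B * Zon * τ :=
    mul_nonneg (mul_nonneg (mul_nonneg (mul_nonneg (by norm_num) hG) hB) hZon) hτ0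
  have t5 : 0 ≤ 2 * A * B * (Z'' - s) * τ :=
    mul_nonneg (mul_nonneg (mul_nonneg (mul_nonneg (by norm_num) hA) hB) (by linarith)) hτ0
  have t6 : 0 ≤ 2 * A * B * (τ * s - u * w) :=
    mul_nonneg (mul_nonneg (mul_nonneg (by norm_num) hA) hB) (by linarith)
  have t7 : 0 ≤ A * B * (w * (P₂ * u - xv'') + u * (P₁ * w - yv'')) := by
    refine mul_nonneg (mul_nonneg hA hB) ?_
    have a3 : 0 ≤ w * (P₂ * u - xv'') := mul_nonneg hw0 (by linarith)
    have a4 : 0 ≤ u * (P₁ * w - yv'') := mul_nonneg hu0 (by linarith)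
    linarith
  have t8 : 0 ≤ B ^ 2 * (2 * (τ * s - u * w)) := mul_nonneg (sq_nonneg _) (by linarith)
  have t9 : 0 ≤ B ^ 2 * C * (u * w) := mul_nonneg (mul_nonneg (sq_nonneg _) hC0) (mul_nonneg hu0 hw0)
  have t10 : 0 ≤ A * B * (u * w) * (2 * C - P₁ - P₂) :=
    mul_nonneg (mul_nonneg (mul_nonneg hA hB) (mul_nonneg hu0 hw0)) h2C
  have t11 : 0 ≤ (A * (C - pit) - B * (1 - C)) *
      (A * (u * (y'' - w) + w * (x'' - u)) + G * (u * yon + w * xon)) := by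
    refine mul_nonneg hW ?_
    have a5 : 0 ≤ A * (u * (y'' - w) + w * (x'' - u)) :=
      mul_nonneg hA (add_nonneg (mul_nonneg hu0 hyv_) (mul_nonneg hw0 hxv_))
    have a6 : 0 ≤ G * (u * yon + w * xon) :=
      mul_nonneg hG (add_nonneg (mul_nonneg hu0 hyon) (mul_nonneg hw0 hxon))
    linarith
  have t12 : 0 ≤ A ^ 2 * (C - pit) * (u * w + (x'' - u) * (y'' - w)) :=
    mul_nonneg (mul_nonneg (sq_nonneg _) hCp) (add_nonneg (mul_nonneg hu0 hw0) (mul_nonneg hxv_ hyv_))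
  have t13 : 0 ≤ A * G * (C - pit) * ((x'' - u) * yon + xon * (y'' - w)) :=
    mul_nonneg (mul_nonneg (mul_nonneg hA hG) hCp)
      (add_nonneg (mul_nonneg hxv_ hyon) (mul_nonneg hxon hyv_))
  exact add_nonneg (add_nonneg (add_nonneg (add_nonneg (add_nonneg (add_nonneg (add_nonneg
    (add_nonneg (add_nonneg (add_nonneg t1 t2) t3) t4) t5) t6) t7) t8) t9) t10)
    (add_nonneg (add_nonneg t11 t12) t13)

/-- The three-route blob model's weights satisfy the weight condition: with `A = (1 − ζ)(1 − a·r) +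
(1 − a)ζ(1 − r)`, `B = aζ(1 − r)`, `C = π̃ + aζ(1 − π̃)`, `(1 − C)·B ≤ (C − π̃)·A` since
`A − (1 − aζ)(1 − r) = r(1 − a)(1 − ζ) ≥ 0`. -/
lemma blob_weight_condition {a ζ r pit : R} (ha : 0 ≤ a) (ha' : a ≤ 1) (hζ : 0 ≤ ζ)
    (hζ' : ζ ≤ 1) (hr : 0 ≤ r) (hpit' : pit ≤ 1) :
    (1 - (pit + a * ζ * (1 - pit))) * (a * ζ * (1 - r)) ≤
      ((pit + a * ζ * (1 - pit)) - pit) * ((1 - ζ) * (1 - a * r) + (1 - a) * ζ * (1 - r)) := by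
  have h1 : 0 ≤ a * ζ := mul_nonneg ha hζ
  have h2 : 0 ≤ 1 - pit := by linarith
  have h3 : 0 ≤ r * (1 - a) * (1 - ζ) := mul_nonneg (mul_nonneg hr (by linarith)) (by linarith)
  have key : ((pit + a * ζ * (1 - pit)) - pit) * ((1 - ζ) * (1 - a * r) + (1 - a) * ζ * (1 - r)) -
      (1 - (pit + a * ζ * (1 - pit))) * (a * ζ * (1 - r)) =
      a * ζ * (1 - pit) * (r * (1 - a) * (1 - ζ)) := by ring
  have h4 : 0 ≤ a * ζ * (1 - pit) * (r * (1 - a) * (1 - ζ)) := mul_nonneg (mul_nonneg h1 h2) h3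
  linarith

end Summit.Ventures.PercRepro2.CrossAPrimeMixtureAlgebra
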